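import Summits.BirchSwinnertonDyer.Rank1Residual.Additive.X3BranchIsogenyCharacters
import Summits.BirchSwinnertonDyer.Rank1Residual.Additive.X3BranchDatum
import Summits.BirchSwinnertonDyer.Rank1Residual.X2.EulerFactorInvariants
import Summits.BirchSwinnertonDyer.Rank1Residual.X2.GreenbergVatsalAnalyticTransferCore
import Literature.NumberTheory.EllipticCurves.GreenbergVatsal2000.EisensteinCongruenceResidualBranch
import HarnessLib

/-!
# X3 on the semistable-twist locus, cell (G-ord, `e = 2`): the ANALYTIC HALF of "Greenberg–Vatsal on
# the `ω^{(p−1)/2}`-branch" as a KERNEL THEOREM from print, and the composition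
# Wuthrich Thm. 16 ∧ GV Thm. (3.12)-on-the-branch ∧ [algebraic residual count] ⟹ the branch main
# conjecture (cell `bsd-addord`, seat `bsd-addord-twist`, strategy = twist transport; FULL-BSD
# rank-≤1 programme D-0033 tranche 1a, row B2 X3-share; candidate T-X3-χ of the seat memo §4)

HONEST FRAMING (cell `bsd-addord`, `run/shared/lean/pub/bsd-addord/README.md` §4): the programme's
target of record is the full Birch–Swinnerton-Dyer formula for every `E/ℚ` of analytic rank `≤ 1`;
this file concerns ONE construction-shaped class of the complement — X3 (additive `p`, `E[p]`
REDUCIBLE) on the semistable-twist locus, cell (G-ord, `e = 2`) — and books NOTHING: X3 stays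
CONSTRUCTION-SHAPED. THEOREMS ONLY (no `def`, no named fact minted, no `sorry`); every published
input is an explicit named-fact binder of the tree (`hW16` = Wuthrich 2014 Thm. 16 half-eigen
reading; `hGV` = Greenberg–Vatsal 2000 Thm. (3.12) + (26)–(28) + pp. 41–43 / §2 pp. 28–29 read on
the `ω^{(p−1)/2}`-branch at a GOOD ORDINARY prime, the accepted reading-fact
`GreenbergVatsal2000.thm312_branch_unitContent_and_lambda_eq_residual_goodOrd` of cell `bsd-eis`
seat x3, p396718, whose `p ≡ 1 (mod 4)` case is this seat's p396680
`thm311_quadraticTwist_hasUnitContent_iff_and_order_eq_of_lineRamifiedEven`); the ONE unprinted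
input — the ALGEBRAIC residual count on the branch — is a DISPLAYED HYPOTHESIS `hAlg`, never
asserted.

## The object and the division of labour (x-cell, `run/shared/lean/pub/bsd-eis/STATUS.md` 09:12Z/09:18Z)

`(E, p)` = `(W, p)` an X3 pair with `E` additive at `p` of Delbourgo type (G)-ordinary and
semistability defect `2`; `V = E♭ := E ⊗ χ_{p*}` its GOOD ORDINARY twist model
(`C • V^{(p*)} = W`), `V[p]` reducible, `m = (p−1)/2`. The LOWER half of `BSD(E,p)` is the
`ω^m`-BRANCH main conjecture of `V` (`X3Branch.X3BranchMainConjectureAt V p`, team n1011), whose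
published half is Wuthrich's Thm. 16 and whose missing half Greenberg–Vatsal's METHOD would give on
the rows where the line `Φ_E ≤ E[p]` with `Φ_E ⊗ χ_{p*}` ramified at `p` is EVEN (= x3's
`BranchGVParAt V p`; = `GVPar V p` for `p ≡ 1 (mod 4)`, the opposite parity for `p ≡ 3 (mod 4)`):
  (P1) ANALYTIC: `μ(ϖ·L_p(V, ω^m, T)) = 0` and
       `λ(ϖ·L_p(V,ω^m,T)) + Σ_{ℓ∈Σ₀} δ_ℓ(E) = dim H¹(ℚ_Σ/ℚ_∞, Φ_E) + dim U(E[p]/Φ_E)` — GV Thm. (3.12)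
       at `χ = ω^m` with Ferrero–Washington / Mazur–Wiles, PRINTED for `V` good ordinary (`hGV`);
  (P2) `char_Λ e_m X(V/ℚ(μ_{p^∞})) ∣ ϖ·L_p(V, ω^m, T)` — Wuthrich Thm. 16 (`hW16`);
  (P3) ALGEBRAIC: for a generator `g` of `char_Λ e_m X` with `μ(g) = 0`,
       `λ(g) + Σ_{ℓ∈Σ₀} δ_ℓ(E) = dim H¹(ℚ_Σ/ℚ_∞, Φ_E) + dim U(E[p]/Φ_E)` — GV §2 (16)/(11) run at the
       datum `(E[p^∞], ramified ordinary line)` over `ℚ_∞` plus twist descent; NOT in print on a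
       branch `≠ 0` (seat memo App. A = cell `bsd-eis` x3-MEMO-2, the proof memo behind x3's typed
       `X3BranchAlgebraicLambdaAt`); here the displayed hypothesis `hAlg`;
  (P4) `μ`, `λ` agree and one divides the other ⟹ equality (GV p. 4; `Λ`-algebra).
By the x-cell division this seat owns the PRINTED half and its consumers: THIS FILE proves P1 as a
kernel theorem in `Λ`-form (§1), P4 as the composition (§2), and the converse (§2: under `hGV`
and a modularity datum the branch main conjecture FORCES the algebraic count, so `hAlg` is EXACTLY
the open content on these rows); the class-level end state (`BSDp` / `Typed.MissingLowerBoundAt`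
on X3♯(G-ord) ∩ `I₀*`, both parities, `p = 3` included off the degenerate rows) is the sibling
`X3BranchAnalyticHalfGordEndState.lean`. The multiplicative half (cell (M): `V` multiplicative at
`p`, `χ_{p*}` ramified at `p ∣ N_V`) is OUTSIDE GV's standing hypothesis "`K` unramified at all
primes dividing the level `N`" (referee GAP(§4.2 P1/(M)), lit R1) and is carried as a SEPARATE
open binder (`X3BranchMultCongruence.lean`), per the cell planner's ask T-M311.

## What is PROVED here (0 named facts; `Λ`-algebra over the tree's X2 Euler-factor kernel)

* §0 `X3Branch.hasUnitContent_and_pow_lam_add_of_nonPrimitive_count`: from "`b·∏_{ℓ∈Σ₀}𝒫_ℓ(E)` has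
  unit content and `p^{ord_T(b·∏𝒫 mod p)} = M`" to "`b` has unit content and
  `p^{λ(b) + Σ_{ℓ∈Σ₀} δ_ℓ(E)} = M`" (GV display (9), tree `order_map_toZMod_mul_eulerFactorProduct`).
* §1 `X3Branch.analyticHalf_goodOrd_of_thm312` — **T-X3-χ ANALYTIC HALF, `Λ`-form**: for every
  `b ∈ Λ`, `u ∈ ℤ_pˣ` with `ι b = u·ϖ·L_p(f_V, α_V, ω^m, T)`: `μ(b) = 0` and
  `p^{λ(b) + Σδ} = #H¹(ℚ_Σ/ℚ_∞, Φ₀)·#U(E[p]/Φ₀)` (`residualLineH1`, `residualQuotSelmer` of the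
  ADDITIVE curve `W`).
* §2 `X3Branch.mainConjectureAt_of_thm312_of_algebraicCount` — `hW16 ∧ hGV ∧ hAlg ⟹
  X3BranchMainConjectureAt V p` for `V` good ordinary with `C • V^{(p*)} = W`, a finite `Σ₀ ∌ p`
  containing the bad places `≠ p`, and an EVEN rational line `Φ₀ ≤ W[p]` with non-trivial
  `Γ_ℚ`-action whose `χ_{p*}`-twist is ramified at `p` (the branch parity condition, stated on `W`);
  `X3Branch.algebraicCount_of_mainConjectureAt_of_thm312` — the CONVERSE.
Proof of §2 (GV p. 4 on the branch): Wuthrich gives `g' = g·h ∈ char X_m = (g)` with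
`ι g' = C(uϖ)B_m`; §1 at `b := g·h` gives `μ(g·h) = 0` (hence `μ(g) = 0`) and
`p^{λ(gh)+Σδ} = #H¹·#U`; `hAlg` at `g` gives `p^{λ(g)+Σδ} = #H¹·#U`; so `λ(gh) = λ(g)`, `h ∈ Λˣ`,
`char X_m = (g')`.

## What this is NOT

Not a class theorem and not a booking: `hAlg` (P3) is OPEN (written in two cells' memos, refereed
as sketch-of-record, not in print, not in the kernel). Not the (M) cell, not `e ∈ {3,4,6}`, not
rank `1`, not the parity-BAD rows (`μ > 0` expected, GV p. 5), not the degenerate `p = 3` rows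
(`{χφ, χψ} = {1, ω}`: excluded by the hypothesis "`Γ_ℚ` acts non-trivially on `Φ₀`"). No label,
tier or count of record moves.

References: R. Greenberg, V. Vatsal, Invent. Math. 142 (2000) [GreenbergVatsal2000] Thm. (1.3),
p. 4, §2 (9), (11), (16) pp. 28–30, §3 Thm. (3.11), Thm. (3.12), (26)–(28), pp. 41–45, Prop. (3.7),
Cor. (3.8); C. Wuthrich, Doc. Math. 19 (2014) [Wuthrich2014] Thm. 16; L. Washington, *Introduction
to Cyclotomic Fields* [Washington1997] §7.1, §13.2; D. Delbourgo, Compositio Math. 113 (1998)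
[Delbourgo1998] §2, Main Conjecture p. 151; cell files `run/shared/lean/pub/bsd-addord/
bsd-addord-twist-MEMO.md` §4/App. A, `REF-twist.md`, `run/shared/lean/pub/bsd-eis/x3-MEMO-2.md`.
-/

set_option autoImplicit false

noncomputable section

open scoped Classical MatrixGroups ModularForm

namespace Summit.BirchSwinnertonDyer.Rank1Residual.Additive

open CongruenceSubgroup WeierstrassCurve NumberField IsDedekindDomain Field
  Literature.NumberTheory.EllipticCurves
  Literature.NumberTheory.EllipticCurves.ModularForms
  Literature.NumberTheory.EllipticCurves.GreenbergVatsal2000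
  Literature.NumberTheory.EllipticCurves.Rank1Residual
  Literature.NumberTheory.EllipticCurves.Rank1Residual.Typed
  Literature.NumberTheory.GaloisRepresentations
  Summit.BirchSwinnertonDyer.Rank1Residual.X1.MuLambda
  Summit.BirchSwinnertonDyer.Rank1Residual.X2.EulerFactorInvariants
  Summit.BirchSwinnertonDyer.Rank1Residual.X2.GreenbergVatsalAnalyticTransferCore
  Summit.BirchSwinnertonDyer.Rank1Residual.AdditivePotMult
  Summit.BirchSwinnertonDyer.Rank1Residual.Additive.X3Branch

/-! ### §0 `Λ`-algebra: from the non-primitive count to `λ(b)` -/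

section Algebra

variable (W : WeierstrassCurve ℚ) {p : ℕ} [hp : Fact p.Prime] (S₀ : Finset (HeightOneSpectrum (𝓞 ℚ)))

/-- **From the non-primitive count to `λ`.** For `p` odd, `Σ₀ ∌ p` finite and `b ∈ Λ`: if
`b · ∏_{ℓ∈Σ₀} 𝒫_ℓ(E)` has unit content and `p^{ord_T(b·∏𝒫_ℓ mod p)} = M`, then `b` has unit
content (`μ(b) = 0`) and `p^{λ(b) + Σ_{ℓ∈Σ₀} δ_E^{(ℓ)}} = M` — Greenberg–Vatsal's display (9)
`λ_{E,Σ₀} = λ_E + Σ δ_E^{(ℓ)}` and "`μ_{E,Σ₀} = μ_E`" (p. 9) in the kernel (tree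
`hasUnitContent_mul_eulerFactorProduct_iff`, `order_map_toZMod_mul_eulerFactorProduct`,
`natCast_lam_eq_order_map_toZMod`). Pure `Λ`-algebra. [cite: GreenbergVatsal2000, §1 p. 9 display (9)] -/
theorem X3Branch.hasUnitContent_and_pow_lam_add_of_nonPrimitive_count (hp2 : p ≠ 2)
    (hS₀ : ∀ v ∈ S₀, ((p : ℕ) : 𝓞 ℚ) ∉ v.asIdeal) {b : IwasawaAlgebra p} {M : ℕ}
    (hu : HasUnitContent (b * eulerFactorProduct W p S₀))
    (hM : p ^ (PowerSeries.map (PadicInt.toZMod (p := p)) (b * eulerFactorProduct W p S₀)).order.toNat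
      = M) :
    HasUnitContent b ∧ p ^ (lam b + ∑ v ∈ S₀, delta W p v) = M := by
  have hS₀' : ∀ v ∈ S₀, Rat.HeightOneSpectrum.natGenerator v ≠ p :=
    fun v hv => natGenerator_ne_of_natCast_not_mem v (hS₀ v hv)
  have hb : HasUnitContent b := (hasUnitContent_mul_eulerFactorProduct_iff W S₀ hp2 hS₀' b).mp hu
  refine ⟨hb, ?_⟩
  have hord : (PowerSeries.map (PadicInt.toZMod (p := p)) (b * eulerFactorProduct W p S₀)).order =
      ((lam b + ∑ v ∈ S₀, delta W p v : ℕ) : ℕ∞) := by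
    rw [order_map_toZMod_mul_eulerFactorProduct W S₀ hp2 hS₀' b, ← natCast_lam_eq_order_map_toZMod hb,
      Nat.cast_add]
  rw [← hM, hord, ENat.toNat_coe]

end Algebra

/-! ### §1 The ANALYTIC HALF on the `ω^{(p−1)/2}`-branch at a (G)-ordinary defect-2 pair, `Λ`-form -/

section AnalyticHalf

variable {V : WeierstrassCurve ℚ} [V.IsElliptic] [V.IsGloballyMinimal]
  {W : WeierstrassCurve ℚ} [W.IsElliptic] [W.IsGloballyMinimal] {p : ℕ} [hp : Fact p.Prime]

/-- **T-X3-χ, ANALYTIC HALF on the `ω^{(p−1)/2}`-branch at a (G)-ordinary defect-2 pair (both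
parities), `Λ`-form — a KERNEL THEOREM from print.** Let `V/ℚ` be globally minimal, GOOD ORDINARY at
the odd prime `p`, `V[p]` reducible, `W` a globally minimal model of `V ⊗ χ_{p*}`
(`C • V^{(p*)} = W`: the ADDITIVE curve `E`), `K` a quadratic field with `θ² = p*`, `κ` cyclotomic,
`f` the newform of `V`, `Σ₀ ∌ p` finite containing every bad place `≠ p`, `Φ₀ ≤ W[p]` a rational
line which is EVEN, carries a non-trivial `Γ_ℚ`-action (`χφ ≠ 1`; automatic for `p ≥ 5`) and whose
`χ_K`-twist is RAMIFIED at `p` (character `χφ`: the branch parity condition `BranchGVParAt V p`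
stated on `W`), `ϖ` the period ratio of the parity of `(p−1)/2`. Then EVERY `b ∈ Λ` with
`ι b = u·ϖ·L_p(f, α_V, ω^{(p−1)/2}, T)` (`u ∈ ℤ_pˣ`) has unit content (`μ^{an} = 0`) and
`p^{λ(b) + Σ_{ℓ∈Σ₀} δ_E^{(ℓ)}} = #H¹(ℚ_Σ/ℚ_∞, Φ₀) · #U(W[p]/Φ₀)` (`residualLineH1`,
`residualQuotSelmer`: GV's residual groups of pp. 28–29 for the characters `χφ` (even, no condition
at `p`) and `χψ` (odd, unramified)). Input: the reading-fact `hGV` = GV Thm. (3.12) + (26)–(28) +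
pp. 41–43 + §2 pp. 28–29 at `χ = ω^{(p−1)/2}` (Ferrero–Washington, Mazur–Wiles folded in), then §0.
This is step P1 of the seat memo's T-X3-χ (§4.2) — there phrased "`μ^{an}(E) = 0` and
`λ^{an}_{Σ₀}(E) = λ_{φ_E,Σ₀} + λ_{ψ_E,Σ₀}`" — in the tree's currency.
[cite: GreenbergVatsal2000, §3 Thm. (3.12) p. 45, (26)–(28) pp. 41–42, p. 43; §2 pp. 28–29; §1 display (9)] -/
theorem X3Branch.analyticHalf_goodOrd_of_thm312
    (hGV : thm312_branch_unitContent_and_lambda_eq_residual_goodOrd)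
    (K : Type) [Field K] [NumberField K] [(galRange (K := ℚ) K).Normal]
    (κ : ZpExtension ℚ p) {N : ℕ} [NeZero N] (f : CuspForm (Gamma0 N) 2)
    (S₀ : Finset (HeightOneSpectrum (𝓞 ℚ)))
    (Φ₀ : AddSubgroup (W.geomTorsion (p : ℤ))) (hΦ : IsRationalLine W p Φ₀)
    (hp2 : p ≠ 2) (hgood : GoodOrd V p) (hirr : ¬ V.HasIrreducibleModPGaloisRep p)
    (h2 : Module.finrank ℚ K = 2) (hθ : ∃ θ : K, θ ^ 2 = algebraMap ℚ K ((-1) ^ (p / 2) * p))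
    (htw : ∃ C : VariableChange ℚ, C • V.quadraticTwist ((-1) ^ (p / 2) * p : ℚ) = W)
    (hκ : κ.IsCyclotomic) (hf : IsNewformOf V f) (heven : LineEven W p Φ₀)
    (hnt : ∃ (σ : absoluteGaloisGroup ℚ) (P : W.geomTorsion (p : ℤ)), P ∈ Φ₀ ∧ σ • P ≠ P)
    (hram : ¬ ∀ v : HeightOneSpectrum (𝓞 ℚ), ((p : ℕ) : 𝓞 ℚ) ∈ v.asIdeal →
        ∀ 𝔓 ∈ v.primesAbove, ∀ σ ∈ 𝔓.inertia (absoluteGaloisGroup ℚ), ∀ P ∈ Φ₀,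
          σ • P = (if σ ∈ galRange (K := ℚ) K then P else -P))
    (hS₀ : ∀ v ∈ S₀, ((p : ℕ) : 𝓞 ℚ) ∉ v.asIdeal)
    (hS : ∀ v : HeightOneSpectrum (𝓞 ℚ), v ∉ S₀ → ((p : ℕ) : 𝓞 ℚ) ∉ v.asIdeal →
      W.HasGoodReductionAt v)
    (ϖ : ℚ) (hϖ : if Even (p / 2) then (ϖ : ℝ) * V.realPeriodRat = plusPeriod f
        else (ϖ : ℝ) * V.imaginaryPeriodRat = minusPeriod f)
    (b : IwasawaAlgebra p) (u : ℤ_[p]ˣ)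
    (hι : iwasawaToPowerSeries p b =
        PowerSeries.C ((((u : ℤ_[p]) : ℚ_[p])) * ((ϖ : ℚ) : ℚ_[p])) *
          (if Even (p / 2) then padicLFunctionBranch f ((unitRoot V p : ℤ_[p]) : ℚ_[p]) (p / 2)
            else padicLFunctionMinusBranch f ((unitRoot V p : ℤ_[p]) : ℚ_[p]) (p / 2))) :
    HasUnitContent b ∧
      p ^ (lam b + ∑ v ∈ S₀, delta W p v) =
        Nat.card (residualLineH1 W p κ S₀ Φ₀ hΦ) * Nat.card (residualQuotSelmer W p κ S₀ Φ₀ hΦ) := by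
  obtain ⟨hu, hM⟩ := hGV V W p K κ f S₀ Φ₀ hΦ hp2 hgood.1 hgood.2 hirr h2 hθ htw hκ hf heven hnt hram
    hS₀ hS ϖ hϖ b u hι
  exact X3Branch.hasUnitContent_and_pow_lam_add_of_nonPrimitive_count W S₀ hp2 hS₀ hu hM

end AnalyticHalf

/-! ### §2 Composition: Wuthrich Thm. 16 ∧ GV Thm. (3.12) on the branch ∧ the ALGEBRAIC residual count ⟹ the branch main conjecture -/

section Composition

variable {V : WeierstrassCurve ℚ} [V.IsElliptic] [V.IsGloballyMinimal]
  {W : WeierstrassCurve ℚ} [W.IsElliptic] [W.IsGloballyMinimal] {p : ℕ} [hp : Fact p.Prime]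

omit [V.IsElliptic] in
/-- At a GOOD prime the reduction-type disjunction of the branch telescope (good ordinary / split
/ non-split multiplicative, as in `Wuthrich2014.thm16_halfEigenCharIdeal_dvd_cyclotomicPrime`)
collapses to its good-ordinary member: multiplicative reduction excludes good reduction
(Silverman *AEC* VII.5.1; tree `not_hasGoodReductionAtPrime_of_hasMultiplicativeReductionAtPrime`).
[cite: SilvermanAEC2009, VII.5 Prop. 5.1] -/
theorem X3Branch.branch_eq_of_goodOrd (hgood : GoodOrd V p) {N : ℕ} [NeZero N]
    {f : CuspForm (Gamma0 N) 2} {B : PowerSeries ℚ_[p]}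
    (hred : (IsOrdinaryAt V p ∧
        B = if Even (p / 2) then padicLFunctionBranch f ((unitRoot V p : ℤ_[p]) : ℚ_[p]) (p / 2)
          else padicLFunctionMinusBranch f ((unitRoot V p : ℤ_[p]) : ℚ_[p]) (p / 2)) ∨
      (V.HasSplitMultiplicativeReductionAtPrime p ∧
        B = if Even (p / 2) then padicLFunctionPlusBranchMult f (1 : ℚ_[p]) (p / 2)
          else padicLFunctionMinusBranchMult f (1 : ℚ_[p]) (p / 2)) ∨
      (V.HasMultiplicativeReductionAtPrime p ∧ ¬ V.HasSplitMultiplicativeReductionAtPrime p ∧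
        B = if Even (p / 2) then padicLFunctionPlusBranchMult f (-1 : ℚ_[p]) (p / 2)
          else padicLFunctionMinusBranchMult f (-1 : ℚ_[p]) (p / 2))) :
    B = if Even (p / 2) then padicLFunctionBranch f ((unitRoot V p : ℤ_[p]) : ℚ_[p]) (p / 2)
      else padicLFunctionMinusBranch f ((unitRoot V p : ℤ_[p]) : ℚ_[p]) (p / 2) := by
  rcases hred with ⟨-, hB⟩ | ⟨hsplit, -⟩ | ⟨hmult, -, -⟩
  · exact hB
  · exact absurd hgood.1 (not_hasGoodReductionAtPrime_of_hasMultiplicativeReductionAtPrime p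
      hsplit.hasMultiplicativeReductionAtPrime)
  · exact absurd hgood.1 (not_hasGoodReductionAtPrime_of_hasMultiplicativeReductionAtPrime p hmult)

/-- **THE COMPOSITION: Wuthrich Thm. 16 ∧ GV Thm. (3.12) on the branch ∧ the ALGEBRAIC residual
count ⟹ the `ω^{(p−1)/2}`-branch main conjecture of `V`** (`X3Branch.X3BranchMainConjectureAt V p`,
the LOWER half of `BSD(E,p)` for the additive `E = W = V ⊗ χ_{p*}` in the twist's clothing).
Setting: `V` GOOD ORDINARY at `p` (so `p` odd on use), `C • V^{(p*)} = W`, `Σ₀ ∌ p` finite with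
every bad place `≠ p` inside, `Φ₀ ≤ W[p]` a rational line, EVEN, with non-trivial `Γ_ℚ`-action,
whose `χ_K`-twist is ramified at `p` for every quadratic `K` with `θ² = p*` (`hram`; the branch
parity condition). PUBLISHED inputs: `hW16` (Wuthrich 2014 Thm. 16, half-eigen reading), `hGV` (GV
2000 Thm. (3.12) on the branch, good ordinary). OPEN input, DISPLAYED: `hAlg` — for every half-eigen
`Λ`-dual datum `D` of `V` on the branch (telescope of `X3BranchAlgebraicLambdaAt`) and every
generator `g` of `char_Λ X_m` with `μ(g) = 0`:
`p^{λ(g) + Σ_{ℓ∈Σ₀} δ_E^{(ℓ)}} = #H¹(ℚ_Σ/ℚ_∞, Φ₀) · #U(W[p]/Φ₀)` — Greenberg–Vatsal's §2 (16) with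
(11) run for the datum `(E[p^∞], ramified ordinary line)` over `ℚ_∞` and twist descent
`e_m X(V/ℚ(μ_{p^∞})) = X(E/ℚ_∞)` (seat memo App. A; cell `bsd-eis` x3-MEMO-2; NOT in print, NOT
asserted). Proof = GV p. 4 on the branch: Wuthrich gives `g' = g·h ∈ char X_m = (g)` with
`ι g' = C(uϖ)B_m`; the analytic half (§1) at `b := g·h` gives `μ(gh) = 0` — hence `μ(g) = 0` — and
`p^{λ(gh)+Σδ} = #H¹·#U`; `hAlg` gives `p^{λ(g)+Σδ} = #H¹·#U`; so `λ(gh) = λ(g)`, `h ∈ Λˣ`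
(`span_mul_eq_span_of_hasUnitContent_of_lam_le`) and `char X_m = (g')`. NOT a class theorem.
[cite: GreenbergVatsal2000, p. 4 (after Thm. (1.2)), §2 (16) p. 29, §3 Thm. (3.12) p. 45 and p. 43]
[cite: Wuthrich2014, Thm. 16 (p. 397)] -/
theorem X3Branch.mainConjectureAt_of_thm312_of_algebraicCount
    (hW16 : Wuthrich2014.thm16_halfEigenCharIdeal_dvd_cyclotomicPrime)
    (hGV : thm312_branch_unitContent_and_lambda_eq_residual_goodOrd)
    (hgood : GoodOrd V p)
    (htw : ∃ C : VariableChange ℚ, C • V.quadraticTwist ((-1) ^ (p / 2) * p : ℚ) = W)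
    (S₀ : Finset (HeightOneSpectrum (𝓞 ℚ))) (hS₀ : ∀ v ∈ S₀, ((p : ℕ) : 𝓞 ℚ) ∉ v.asIdeal)
    (hS : ∀ v : HeightOneSpectrum (𝓞 ℚ), v ∉ S₀ → ((p : ℕ) : 𝓞 ℚ) ∉ v.asIdeal →
      W.HasGoodReductionAt v)
    (Φ₀ : AddSubgroup (W.geomTorsion (p : ℤ))) (hΦ : IsRationalLine W p Φ₀)
    (heven : LineEven W p Φ₀)
    (hnt : ∃ (σ : absoluteGaloisGroup ℚ) (P : W.geomTorsion (p : ℤ)), P ∈ Φ₀ ∧ σ • P ≠ P)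
    (hram : ∀ (K : Type) [Field K] [NumberField K] [(galRange (K := ℚ) K).Normal],
      Module.finrank ℚ K = 2 → (∃ θ : K, θ ^ 2 = algebraMap ℚ K ((-1) ^ (p / 2) * p)) →
      ¬ ∀ v : HeightOneSpectrum (𝓞 ℚ), ((p : ℕ) : 𝓞 ℚ) ∈ v.asIdeal →
        ∀ 𝔓 ∈ v.primesAbove, ∀ σ ∈ 𝔓.inertia (absoluteGaloisGroup ℚ), ∀ P ∈ Φ₀,
          σ • P = (if σ ∈ galRange (K := ℚ) K then P else -P))
    (hAlg : ∀ (K : Type) [Field K] [NumberField K] [(galRange (K := ℚ) K).Normal]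
      (F : Type) [Field F] [NumberField F] [IsCyclotomicExtension {p} ℚ F]
      [(galRange (K := ℚ) F).Normal]
      {κ : ZpExtension ℚ p} {γ : Field.absoluteGaloisGroup ℚ},
      p ≠ 2 → Module.finrank ℚ K = 2 →
      (∃ θ : K, θ ^ 2 = algebraMap ℚ K ((-1) ^ (p / 2) * p)) →
      ¬ V.HasIrreducibleModPGaloisRep p →
      κ.IsCyclotomic → κ.IsTopGenerator γ → IsCyclotomicVariable p γ →
      γ ∈ galRange (K := ℚ) K → γ ∈ galRange (K := ℚ) F →
      ∀ (D : V.EigenSelmerDualData p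
          (κ.kerSubgroup ⊓ galRange (K := ℚ) K ⊓ galRange (K := ℚ) F) κ.kerSubgroup
          (fun g ↦ if g ∈ galRange (K := ℚ) K then 1 else -1) γ)
        (g : IwasawaAlgebra p), D.charIdeal = Ideal.span {g} → HasUnitContent g →
          p ^ (lam g + ∑ v ∈ S₀, delta W p v) =
            Nat.card (residualLineH1 W p κ S₀ Φ₀ hΦ) * Nat.card (residualQuotSelmer W p κ S₀ Φ₀ hΦ)) :
    X3BranchMainConjectureAt V p := by
  intro K _ _ _ F _ _ _ _ κ γ N _ f B hp2 h2 hθ hred hirr hκ hγ hcyc hγK hγF hf D ϖ hϖ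
  obtain ⟨htors, g', hg'mem, u, hι⟩ :=
    hW16 p V K F B hp2 h2 hθ hred hirr hκ hγ hcyc hγK hγF hf D ϖ hϖ
  refine ⟨htors, ?_⟩
  have hB := X3Branch.branch_eq_of_goodOrd hgood hred
  -- `char X_m = (g)` is principal; `g' = g·h`
  obtain ⟨g, hg⟩ := (charIdeal_isPrincipal_holds p D.X).principal
  have hchar : D.charIdeal = Ideal.span {g} := hg
  have hdvd : g ∣ g' := by
    rw [hchar] at hg'mem
    exact Ideal.mem_span_singleton.mp hg'mem
  obtain ⟨h, hfac⟩ := hdvd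
  subst hfac
  -- the analytic half at `b := g·h ∈ Λ`
  have hιB : iwasawaToPowerSeries p (g * h) =
      PowerSeries.C ((((u : ℤ_[p]) : ℚ_[p])) * ((ϖ : ℚ) : ℚ_[p])) *
        (if Even (p / 2) then padicLFunctionBranch f ((unitRoot V p : ℤ_[p]) : ℚ_[p]) (p / 2)
          else padicLFunctionMinusBranch f ((unitRoot V p : ℤ_[p]) : ℚ_[p]) (p / 2)) := by
    rw [hι, hB]
  obtain ⟨hμan, hAn⟩ := X3Branch.analyticHalf_goodOrd_of_thm312 hGV K κ f S₀ Φ₀ hΦ hp2 hgood hirr h2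
    hθ htw hκ hf heven hnt (hram K h2 hθ) hS₀ hS ϖ hϖ (g * h) u hιB
  have hμalg : HasUnitContent g := X11a.hasUnitContent_left_of_mul hμan
  -- the algebraic half at `g`
  have hAl := hAlg K F hp2 h2 hθ hirr hκ hγ hcyc hγK hγF D g hchar hμalg
  have hlam : lam (g * h) = lam g := by
    have hpow : p ^ (lam (g * h) + ∑ v ∈ S₀, delta W p v) = p ^ (lam g + ∑ v ∈ S₀, delta W p v) :=
      hAn.trans hAl.symm
    have := Nat.pow_right_injective hp.out.two_le hpow
    omega
  refine ⟨g * h, hchar.trans ?_, u, hι⟩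
  exact (span_mul_eq_span_of_hasUnitContent_of_lam_le (X11a.ne_zero_of_hasUnitContent hμalg) hμan
    hlam.le).symm


/-- **CONVERSE — the algebraic residual count is NECESSARY.** In the setting of
`X3Branch.mainConjectureAt_of_thm312_of_algebraicCount` (plus `p ≠ 2` and a modularity datum
`hmodD`, used only to inhabit the newform / branch-series / period-ratio telescope through
`X3Branch.exists_datum_of_twist`), the branch main conjecture `X3BranchMainConjectureAt V p` and GV
Thm. (3.12) on the branch (`hGV`) give, for EVERY half-eigen datum `D` and EVERY generator `g` of
`char_Λ X_m`: `μ(g) = 0` and `p^{λ(g) + Σ_{ℓ∈Σ₀} δ_E^{(ℓ)}} = #H¹(ℚ_Σ/ℚ_∞, Φ₀)·#U(W[p]/Φ₀)` —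
`(g) = (g')` with `ι g' = C(uϖ)B_m`, so `g`, `g'` have the same content and `λ`, and §1 applies to
`g'`. Hence, granted print, the displayed hypothesis `hAlg` of the composition is EXACTLY the open
content of the branch main conjecture on these rows (kernel form of "what X3♯(G-ord, e = 2) lacks is
Greenberg–Vatsal's ALGEBRAIC `λ`-count on the branch"). [cite: GreenbergVatsal2000, p. 4, §2 (16) p. 29, §3 Thm. (3.12) p. 45]
[cite: Wuthrich2014, Thm. 16 (p. 397) (binder shape)] -/
theorem X3Branch.algebraicCount_of_mainConjectureAt_of_thm312
    (hmodD : nonempty_modularParametrizationData)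
    (hGV : thm312_branch_unitContent_and_lambda_eq_residual_goodOrd)
    (hp2 : p ≠ 2) (hgood : GoodOrd V p)
    (htw : ∃ C : VariableChange ℚ, C • V.quadraticTwist ((-1) ^ (p / 2) * p : ℚ) = W)
    (S₀ : Finset (HeightOneSpectrum (𝓞 ℚ))) (hS₀ : ∀ v ∈ S₀, ((p : ℕ) : 𝓞 ℚ) ∉ v.asIdeal)
    (hS : ∀ v : HeightOneSpectrum (𝓞 ℚ), v ∉ S₀ → ((p : ℕ) : 𝓞 ℚ) ∉ v.asIdeal →
      W.HasGoodReductionAt v)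
    (Φ₀ : AddSubgroup (W.geomTorsion (p : ℤ))) (hΦ : IsRationalLine W p Φ₀)
    (heven : LineEven W p Φ₀)
    (hnt : ∃ (σ : absoluteGaloisGroup ℚ) (P : W.geomTorsion (p : ℤ)), P ∈ Φ₀ ∧ σ • P ≠ P)
    (hram : ∀ (K : Type) [Field K] [NumberField K] [(galRange (K := ℚ) K).Normal],
      Module.finrank ℚ K = 2 → (∃ θ : K, θ ^ 2 = algebraMap ℚ K ((-1) ^ (p / 2) * p)) →
      ¬ ∀ v : HeightOneSpectrum (𝓞 ℚ), ((p : ℕ) : 𝓞 ℚ) ∈ v.asIdeal →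
        ∀ 𝔓 ∈ v.primesAbove, ∀ σ ∈ 𝔓.inertia (absoluteGaloisGroup ℚ), ∀ P ∈ Φ₀,
          σ • P = (if σ ∈ galRange (K := ℚ) K then P else -P))
    (hMC : X3BranchMainConjectureAt V p)
    (K : Type) [Field K] [NumberField K] [(galRange (K := ℚ) K).Normal]
    (F : Type) [Field F] [NumberField F] [IsCyclotomicExtension {p} ℚ F]
    [(galRange (K := ℚ) F).Normal]
    {κ : ZpExtension ℚ p} {γ : Field.absoluteGaloisGroup ℚ}
    (h2 : Module.finrank ℚ K = 2) (hθ : ∃ θ : K, θ ^ 2 = algebraMap ℚ K ((-1) ^ (p / 2) * p))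
    (hirr : ¬ V.HasIrreducibleModPGaloisRep p)
    (hκ : κ.IsCyclotomic) (hγ : κ.IsTopGenerator γ) (hcyc : IsCyclotomicVariable p γ)
    (hγK : γ ∈ galRange (K := ℚ) K) (hγF : γ ∈ galRange (K := ℚ) F)
    (D : V.EigenSelmerDualData p
        (κ.kerSubgroup ⊓ galRange (K := ℚ) K ⊓ galRange (K := ℚ) F) κ.kerSubgroup
        (fun g ↦ if g ∈ galRange (K := ℚ) K then 1 else -1) γ)
    (g : IwasawaAlgebra p) (hchar : D.charIdeal = Ideal.span {g}) :
    HasUnitContent g ∧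
      p ^ (lam g + ∑ v ∈ S₀, delta W p v) =
        Nat.card (residualLineH1 W p κ S₀ Φ₀ hΦ) * Nat.card (residualQuotSelmer W p κ S₀ Φ₀ hΦ) := by
  -- a newform / branch series / period ratio for `V` (modularity datum)
  obtain ⟨C, hC⟩ := htw
  have hpS : ((-1 : ℚ) ^ (p / 2) * p) ≠ 0 := pStar_ne_zero p
  have hredW : ¬ Irr W p :=
    fun hW ↦ hirr ((irr_iff_of_model_twist (W := V) (p := p) hpS ⟨C, hC⟩).mp hW)
  obtain ⟨-, -, -, -, -, -, -, -, -, -, -, N, _, f, B, -, ϖ, -, -, hred, -, -, -, -, -, -, hf, hϖ⟩ :=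
    X3Branch.exists_datum_of_twist (W := W) hmodD hp2 hredW hC (Or.inl hgood)
  -- the branch main conjecture at this telescope: `char X_m = (g')`, `ι g' = C(uϖ)B`
  obtain ⟨-, g', hchar', u, hι⟩ := hMC K F B hp2 h2 hθ hred hirr hκ hγ hcyc hγK hγF hf D ϖ hϖ
  have hB := X3Branch.branch_eq_of_goodOrd hgood hred
  have hιB : iwasawaToPowerSeries p g' =
      PowerSeries.C ((((u : ℤ_[p]) : ℚ_[p])) * ((ϖ : ℚ) : ℚ_[p])) *
        (if Even (p / 2) then padicLFunctionBranch f ((unitRoot V p : ℤ_[p]) : ℚ_[p]) (p / 2)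
          else padicLFunctionMinusBranch f ((unitRoot V p : ℤ_[p]) : ℚ_[p]) (p / 2)) := by
    rw [hι, hB]
  obtain ⟨hμ', hcount'⟩ := X3Branch.analyticHalf_goodOrd_of_thm312 hGV K κ f S₀ Φ₀ hΦ hp2 hgood hirr
    h2 hθ ⟨C, hC⟩ hκ hf heven hnt (hram K h2 hθ) hS₀ hS ϖ hϖ g' u hιB
  -- `(g) = (g')`: same unit content, same `λ`
  have hspan : Ideal.span ({g} : Set (IwasawaAlgebra p)) = Ideal.span {g'} := hchar ▸ hchar'
  have hμ : HasUnitContent g := (hasUnitContent_congr_of_span_eq hspan).mpr hμ'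
  refine ⟨hμ, ?_⟩
  have hg0 : g ≠ 0 := X11a.ne_zero_of_hasUnitContent hμ
  have hg'0 : g' ≠ 0 := X11a.ne_zero_of_hasUnitContent hμ'
  obtain ⟨w, hw⟩ := Ideal.span_singleton_eq_span_singleton.mp hspan.symm
  have hlam : lam g = lam g' := ((span_eq_span_iff_mu_lam hg'0 hg0 hw.symm).mp hspan).2
  rw [hlam]
  exact hcount'

end Composition

end Summit.BirchSwinnertonDyer.Rank1Residual.Additive

end
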